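import Summits.QuantumFields.YangMills.Theorems.BalabanUVNodesN19TargetOfDecorrelationReading

/-!
# YM-DAG node N19 (= NE7 proper) — THE RESPONSE-MATCHING ∕ DECORRELATION ROAD, COMPANION: (i) THE WITNESS «node U5's `Target` HOLDS while the
# N19′ `Core` edge FAILS, at ONE reading» (two law-separated classes with identical source responses), and (ii) THE HYBRID EDITION — bad classes
# booked by relative weight `W` for both runs, the road's letters (RM) + (DC) asked on the good classes only: `|ΔgenFun| ≤ r + κ − 2·log(1 − W)`

Cell `pub-ymgap`, HUMAN RULING D-0062 (Track A), width seat `pub-ymgap-dag-n19-w2` (node n19 = NE7), generation g7 (R455 (A) rule (ii); CLAIM-2 ∕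
DECL-DELTA-2 on the cell bus).  Route `Summits/QuantumFields/YangMills/Theses/BalabanUVNodes.lean`, key item K3⁸ `SpineGivenEndpointR13SepCoPHV`
(stmt-QuantumFields-27366; aside predecessor K3⁷ 20544); filed `--kind proof --supports … --as helper`.  COUNT-NEUTRAL.  THEOREMS ONLY (0 `def`, 0 `sorry`).
ADDITIVE — imports this seat's `…N19TargetOfDecorrelationReading` (the road: `abs_genFunIncr_sub_le_of_response_decorrelation`, `decorrelation_of_classBlindResponse`,
`target_of_responseDecorrelationReading`, `sum_sandwich`, `abs_log_sub_log_le_of_sandwich`) and through it dag-n19-w1's `…N19HybridBeyondTarget`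
(`not_coreEdge_of_unsummable_gap`), dag-n19-e's `…N19CoreMetric`, `Spine/NE7/Targets` — all BY NAME; modifies nothing.

WHAT IS KERNEL-CHECKED ([folklore] finite sums with explicit numerals; the tree's lemmas BY NAME).
* §1 THE WITNESS — `toy_target` ∧ `toy_not_coreEdge`: classes `Bool`; run A weighs `z_K∕2·e^{t}` on both classes, run B `z_K∕2·e^{t}·(e on true, 1 on false)`,
  `z_K = ((1+e)∕2)^K` so that `Σ_T B K t = z_{K+1}e^{t} = Σ_T A (K+1) t` (ONE sequence `Z K t = z_K e^{t}`, two representations — the E1∕E2 dictionary).  The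
  two-run source-free contrast is the LAW-SEPARATING gap `log(B∕A)(true) − log(B∕A)(false) = 1` at EVERY `K` — not summable — so `¬ ∃ δ, NE7.Core … δ ∧ Summable δ`
  (dag-n19-w1's `not_coreEdge_of_unsummable_gap`), for every `vol` and `l₀ ≥ 0`; the responses are IDENTICAL (`e^{t}`): (RM) with `r = 0`, (DC) with
  `κ = 0` (`decorrelation_of_classBlindResponse` at `s = 0`), and `NE7.Target vol l₀ 0 Z` HOLDS (`target_of_responseDecorrelationReading`).  So at one and
  the same reading the node's DECL target holds and the `Core` road's ∃δ-edge fails: the class-uniform constant is a property of the ROAD, not of the TARGET.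
* §2 THE HYBRID EDITION — `log_sum_good_le` ∕ `log_sum_le_log_sum_good_sub` (a run whose bad mass is `≤ W·`total, `W < 1`, has
  `log Σ_G ≤ log Σ_T ≤ log Σ_G − log(1 − W)`), `abs_incr_sub_incrGood_le` (so its generating-function increment over `T` is within `−log(1−W)` of the
  one over the good set `G`), ★ `abs_genFunIncr_sub_le_of_response_decorrelation_bad`: a `t`-independent good set `G ⊆ T`, both runs' bad mass
  `Σ_{T∖G} X_t ≤ W·Σ_T X_t` at `t` and at `0`, (RM) with `r` and (DC) with `κ` ON `G` ONLY ⇒ `|ΔgenFun over T| ≤ r + κ − 2·log(1 − W)` — the road composes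
  with node N20's weight face exactly like `Core` does in `T4WeightBudget.hybridSandwich_of_relWeightBound` (rare classes cost weight, never a rate).
* §3 ALONG `K` — `target_of_responseDecorrelationReading_bad`: the hybrid reading along `K` (`r_K + κ_K − 2 log(1 − W_K) ≤ vol·δ_K`, `Σδ_K < ∞`) ⇒
  `NE7.Target vol l₀ δ Z` with canonical constants.
* §4 THE AGING LETTER — ★ `decorrelation_of_conditionallyBlindResponse`: classes old × recent with ARBITRARY positive source-free weights, contrast on the
  old coordinate only, and run A's loop response class-blind ON AVERAGE OVER THE RECENT COORDINATE uniformly in the old one («conditionally on the old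
  large-field structure the class-averaged loop response is the same» up to `s`) ⇒ (DC) with `κ = 2s` — generalises FILE C's product (`s = 0`) and
  pointwise class-blind sources; this is the form in which (DC) is an AGING statement about one run.

HONEST FRAMING.  Hypothesis SHAPES on positive finite class weights, produced by nobody for Bałaban's runs; the toy is a two-class caricature, not a
reading of any datum; ZERO Bałaban content; NE7 ∕ NE7b NOT PRINTED for d = 4 ∕ NOT proved; N19 ∕ N20 NOT discharged; K3⁸ 27366 OPEN («v6» pending
registration), K3⁷ 20544 aside, neither claimed — K3's stub 2 is typed on the `Core` road and is NOT served by this file; counts UNMOVED (typed 28∕28 ·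
discharged 5∕27, A 5∕28); no count claim.  One finite four-torus programme at fixed ε, Bałaban AS PRINTED; R4 closes the conditional finite-𝕋⁴ rung
`BalabanLadder.UV` only — NOT infinite volume, NOT OS on ℝ⁴, NOT the Yang–Mills mass gap, NOT the Clay problem.  0 `def`; 0 `sorry`; standard axioms.
-/

noncomputable section

open Finset Filter
open scoped BigOperators

namespace Summit.QuantumFields.YangMills.BalabanUVNodes.N19TargetOfDecorrelationReadingWitness

open Literature.MathematicalPhysics.QuantumFieldTheory.Balaban1983to89
open Literature.MathematicalPhysics.QuantumFieldTheory.Balaban1983to89.T4CauchySum (MatchingModConstants genFun)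
open Summit.QuantumFields.BalabanUV.T4Continuum.Spine
open Summit.QuantumFields.YangMills.BalabanUVNodes.N19HybridBeyondTarget (not_coreEdge_of_unsummable_gap)
open Summit.QuantumFields.YangMills.BalabanUVNodes.N19TargetOfDecorrelationReading

variable {ι : Type*}

/-! ## §1 THE WITNESS: a law-separating `O(1)` contrast at every `K` — the `Core` edge FAILS, the node's `Target` HOLDS, at one reading -/

section Toy

/-- run A of the toy: both classes weigh `z_K∕2 · e^{t}`, `z_K = ((1+e)∕2)^K`. -/
private theorem toyA_pos (K : ℕ) (t : ℝ) : 0 < ((1 + Real.exp 1) / 2) ^ K / 2 * Real.exp t :=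
  mul_pos (div_pos (pow_pos (by positivity) K) two_pos) (Real.exp_pos t)

/-- **THE TOY's TARGET.**  Classes `Bool`; run A: `A K t τ = z_K∕2·e^{t}` on both classes; run B: `B K t τ = z_K∕2·e^{t}·(`e` on `true`, `1` on `false`)`;
`Z K t = z_K·e^{t}` with `z_K = ((1+e)∕2)^K` (so `Σ_T B K t = z_{K+1} e^{t} = Σ_T A (K+1) t`: ONE sequence, two representations).  The responses are IDENTICAL
(`e^{t}`): (RM) with `r = 0`, (DC) with `κ = 0` by the class-blind response — and `NE7.Target vol l₀ 0 Z` holds (`0 ≤ l₀`, any `vol`). [folklore] -/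
theorem toy_target {vol l₀ : ℝ} (hl₀ : 0 ≤ l₀) :
    NE7.Target vol l₀ (fun _ => 0) (fun K t => ((1 + Real.exp 1) / 2) ^ K * Real.exp t) := by
  refine target_of_responseDecorrelationReading (ι := Bool) hl₀ (fun _ => Finset.univ)
    (fun K t _ => ((1 + Real.exp 1) / 2) ^ K / 2 * Real.exp t)
    (fun K t τ => ((1 + Real.exp 1) / 2) ^ K / 2 * Real.exp t * (bif τ then Real.exp 1 else 1)) (fun _ => 0) (fun _ => 0)
    (fun _ => Finset.univ_nonempty) (fun K t _ τ _ => toyA_pos K t) (fun K t _ τ _ => mul_pos (toyA_pos K t) (by cases τ <;> simp [Real.exp_pos]))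
    ?_ ?_ ?_ ?_ (fun K => by simp) (summable_zero)
  · -- (RM): the responses are identical
    intro K t _ τ _
    have hz : 0 < ((1 + Real.exp 1) / 2) ^ K / 2 := div_pos (pow_pos (by positivity) K) two_pos
    have hf : 0 < (bif τ then Real.exp 1 else (1 : ℝ)) := by cases τ <;> simp [Real.exp_pos]
    rw [Real.log_mul (toyA_pos K t).ne' hf.ne', Real.log_mul (toyA_pos K 0).ne' hf.ne',
      Real.log_mul hz.ne' (Real.exp_pos t).ne', Real.log_mul hz.ne' (Real.exp_pos 0).ne']
    simp
  · -- (DC): class-blind response `φ t = t`, `s = 0`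
    intro K t ht
    have h := decorrelation_of_classBlindResponse (T := (Finset.univ : Finset Bool)) (l₀ := l₀)
      (A := fun t _ => ((1 + Real.exp 1) / 2) ^ K / 2 * Real.exp t)
      (B := fun t τ => ((1 + Real.exp 1) / 2) ^ K / 2 * Real.exp t * (bif τ then Real.exp 1 else 1))
      Finset.univ_nonempty (fun t _ τ _ => toyA_pos K t) (fun τ _ => mul_pos (toyA_pos K 0) (by cases τ <;> simp [Real.exp_pos])) hl₀
      (φ := fun t => t) (s := 0) ?_ ht
    · simpa using h
    · intro t' _ τ _
      have hz : 0 < ((1 + Real.exp 1) / 2) ^ K / 2 := div_pos (pow_pos (by positivity) K) two_pos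
      rw [Real.log_mul hz.ne' (Real.exp_pos t').ne', Real.log_mul hz.ne' (Real.exp_pos 0).ne']
      simp
  · -- dictionary, run A: `Σ_{Bool} z_K/2 e^t = z_K e^t`
    intro K t _
    rw [Fintype.sum_bool]
    ring
  · -- dictionary, run B: `z_K/2 e^t (e + 1) = z_{K+1} e^t`
    intro K t _
    rw [Fintype.sum_bool, cond_true, cond_false, pow_succ]
    ring

/-- **THE TOY's `Core` EDGE FAILS** (dag-n19-w1's guard `not_coreEdge_of_unsummable_gap` BY NAME): the good-class log-ratio gap is the constant
`1 = log e` at every `K` — law-separating, not summable — so `¬ ∃ δ, NE7.Core l₀ vol T ∅ A B δ ∧ Summable δ` for every `vol` and every `l₀ ≥ 0`,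
at the SAME reading at which `toy_target` holds. [folklore] -/
theorem toy_not_coreEdge {vol l₀ : ℝ} (hl₀ : 0 ≤ l₀) :
    ¬ ∃ δ : ℕ → ℝ, NE7.Core l₀ vol (fun _ => (Finset.univ : Finset Bool)) (fun _ _ => ∅)
      (fun K t _ => ((1 + Real.exp 1) / 2) ^ K / 2 * Real.exp t)
      (fun K t τ => ((1 + Real.exp 1) / 2) ^ K / 2 * Real.exp t * (bif τ then Real.exp 1 else 1)) δ ∧ Summable δ := by
  refine not_coreEdge_of_unsummable_gap (g := fun _ => (1 : ℝ)) (fun _ => zero_le_one)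
    (fun h => one_ne_zero ((summable_const_iff (1 : ℝ)).1 h)) fun K => ⟨0, by simpa using hl₀, true, by simp, false, by simp,
      toyA_pos K 0, toyA_pos K 0, ?_⟩
  have hz := toyA_pos K 0
  rw [cond_true, cond_false, mul_one, Real.log_mul hz.ne' (Real.exp_pos 1).ne', Real.log_exp]
  linarith

end Toy

/-! ## §2 THE HYBRID EDITION: bad classes by relative weight, the road's letters on the good classes only -/

section Hybrid

variable [DecidableEq ι] {T G : Finset ι} {X : ι → ℝ} {W : ℝ}

omit [DecidableEq ι] in
/-- A run with positive terms: the good part is at most the total, `log Σ_G X ≤ log Σ_T X` (`G ⊆ T`, `G` nonempty). [folklore] -/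
theorem log_sum_good_le (hG : G ⊆ T) (hGne : G.Nonempty) (hX : ∀ τ ∈ T, 0 < X τ) :
    Real.log (∑ τ ∈ G, X τ) ≤ Real.log (∑ τ ∈ T, X τ) :=
  Real.log_le_log (Finset.sum_pos (fun τ hτ => hX τ (hG hτ)) hGne)
    (Finset.sum_le_sum_of_subset_of_nonneg hG fun τ hτ _ => (hX τ hτ).le)

/-- … and if the bad mass is at most `W·`total with `W < 1`, the total is at most the good part divided by `1 − W`:
`log Σ_T X ≤ log Σ_G X − log(1 − W)`. [folklore] -/
theorem log_sum_le_log_sum_good_sub (hG : G ⊆ T) (hGne : G.Nonempty) (hX : ∀ τ ∈ T, 0 < X τ) (hW : W < 1)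
    (hbad : ∑ τ ∈ T \ G, X τ ≤ W * ∑ τ ∈ T, X τ) :
    Real.log (∑ τ ∈ T, X τ) ≤ Real.log (∑ τ ∈ G, X τ) - Real.log (1 - W) := by
  have hTpos : 0 < ∑ τ ∈ T, X τ := Finset.sum_pos hX (hGne.mono hG)
  have hsplit : ∑ τ ∈ T, X τ = ∑ τ ∈ G, X τ + ∑ τ ∈ T \ G, X τ := (Finset.sum_sdiff hG).symm.trans (add_comm _ _)
  have hkey : (1 - W) * ∑ τ ∈ T, X τ ≤ ∑ τ ∈ G, X τ := by nlinarith [hsplit, hbad]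
  have h1W : 0 < 1 - W := by linarith
  have := Real.log_le_log (mul_pos h1W hTpos) hkey
  rw [Real.log_mul h1W.ne' hTpos.ne'] at this
  linarith

/-- Hence ONE run's generating-function increment over `T` is within `−log(1 − W)` of its increment over the good set `G` (bad mass `≤ W·`total at
`t` and at `0`). [folklore] -/
theorem abs_incr_sub_incrGood_le {Xt X0 : ι → ℝ} (hG : G ⊆ T) (hGne : G.Nonempty) (hXt : ∀ τ ∈ T, 0 < Xt τ) (hX0 : ∀ τ ∈ T, 0 < X0 τ)
    (hW : W < 1) (hbadt : ∑ τ ∈ T \ G, Xt τ ≤ W * ∑ τ ∈ T, Xt τ) (hbad0 : ∑ τ ∈ T \ G, X0 τ ≤ W * ∑ τ ∈ T, X0 τ) :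
    |(Real.log (∑ τ ∈ T, Xt τ) - Real.log (∑ τ ∈ T, X0 τ)) - (Real.log (∑ τ ∈ G, Xt τ) - Real.log (∑ τ ∈ G, X0 τ))| ≤ -Real.log (1 - W) := by
  have a1 := log_sum_good_le hG hGne hXt
  have a2 := log_sum_le_log_sum_good_sub hG hGne hXt hW hbadt
  have b1 := log_sum_good_le hG hGne hX0
  have b2 := log_sum_le_log_sum_good_sub hG hGne hX0 hW hbad0
  rw [abs_le]; constructor <;> linarith

variable {A B : ℝ → ι → ℝ} {l₀ r κ : ℝ}

/-- **THE HYBRID EDITION OF THE ROAD.**  A `t`-independent good set `G ⊆ T` (nonempty), positive class weights on `T`, both runs' bad mass `≤ W·`total at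
every `|t| ≤ l₀` (`W < 1`; node N20's `RelWeightBound` letter at one `K` with a `t`-independent bad class), (RM) with radius `r` and (DC) with radius `κ`
asked ON THE GOOD CLASSES ONLY ⇒ `|(log Σ_T B_t − log Σ_T B_0) − (log Σ_T A_t − log Σ_T A_0)| ≤ r + κ − 2·log(1 − W)`: rare classes cost weight, never a
rate — the road composes with the weight face as `Core` does. [folklore] -/
theorem abs_genFunIncr_sub_le_of_response_decorrelation_bad (hG : G ⊆ T) (hGne : G.Nonempty)
    (hA : ∀ t, |t| ≤ l₀ → ∀ τ ∈ T, 0 < A t τ) (hB : ∀ t, |t| ≤ l₀ → ∀ τ ∈ T, 0 < B t τ) (hl₀ : 0 ≤ l₀) (hW : W < 1)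
    (hbadA : ∀ t, |t| ≤ l₀ → ∑ τ ∈ T \ G, A t τ ≤ W * ∑ τ ∈ T, A t τ)
    (hbadB : ∀ t, |t| ≤ l₀ → ∑ τ ∈ T \ G, B t τ ≤ W * ∑ τ ∈ T, B t τ)
    (hRM : ∀ t, |t| ≤ l₀ → ∀ τ ∈ G,
      |(Real.log (B t τ) - Real.log (B 0 τ)) - (Real.log (A t τ) - Real.log (A 0 τ))| ≤ r)
    (hDC : ∀ t, |t| ≤ l₀ →
      |Real.log (∑ τ ∈ G, B 0 τ * (A t τ / A 0 τ)) - Real.log (∑ τ ∈ G, B 0 τ) -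
        (Real.log (∑ τ ∈ G, A t τ) - Real.log (∑ τ ∈ G, A 0 τ))| ≤ κ)
    {t : ℝ} (ht : |t| ≤ l₀) :
    |(Real.log (∑ τ ∈ T, B t τ) - Real.log (∑ τ ∈ T, B 0 τ)) -
        (Real.log (∑ τ ∈ T, A t τ) - Real.log (∑ τ ∈ T, A 0 τ))| ≤ r + κ - 2 * Real.log (1 - W) := by
  have h0 : |(0 : ℝ)| ≤ l₀ := by simpa using hl₀
  have hgood := abs_genFunIncr_sub_le_of_response_decorrelation (T := G) hGne (fun s hs τ hτ => hA s hs τ (hG hτ))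
    (fun s hs τ hτ => hB s hs τ (hG hτ)) hl₀ hRM hDC ht
  have hAcorr := abs_incr_sub_incrGood_le hG hGne (hA t ht) (hA 0 h0) hW (hbadA t ht) (hbadA 0 h0)
  have hBcorr := abs_incr_sub_incrGood_le hG hGne (hB t ht) (hB 0 h0) hW (hbadB t ht) (hbadB 0 h0)
  rw [abs_le] at hgood hAcorr hBcorr ⊢
  constructor <;> linarith [hgood.1, hgood.2, hAcorr.1, hAcorr.2, hBcorr.1, hBcorr.2]

end Hybrid

/-! ## §3 ALONG `K`, HYBRID: good sets `G K`, bad mass `W K`, the letters on the good classes ⇒ `MatchingModConstants` ⇒ `Target` -/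

section AlongK

variable [DecidableEq ι] {vol l₀ : ℝ} {δ : ℕ → ℝ} {Z : ℕ → ℝ → ℝ}

/-- **`Target` FROM THE HYBRID RESPONSE-MATCHING ∕ DECORRELATION READING.**  ONE sequence `Z` READ through the dictionary `Z K t = Σ_{T K} A K t`,
`Z (K+1) t = Σ_{T K} B K t` on `|t| ≤ l₀`; per `K` a `t`-independent nonempty good set `G K ⊆ T K`, both runs' bad mass `≤ W K·`total (`W K < 1`), (RM)_K and
(DC)_K on `G K` with `r K + κ K − 2·log(1 − W K) ≤ vol·δ K`, `Summable δ` ⇒ `NE7.Target vol l₀ δ Z` (canonical constants, via n19-e's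
`matchingModConstants_of_genFun_increments`). [folklore] -/
theorem target_of_responseDecorrelationReading_bad (hl₀ : 0 ≤ l₀) (T G : ℕ → Finset ι) (A B : ℕ → ℝ → ι → ℝ) (r κ W : ℕ → ℝ)
    (hG : ∀ K, G K ⊆ T K) (hGne : ∀ K, (G K).Nonempty)
    (hA : ∀ K t, |t| ≤ l₀ → ∀ τ ∈ T K, 0 < A K t τ) (hB : ∀ K t, |t| ≤ l₀ → ∀ τ ∈ T K, 0 < B K t τ) (hW : ∀ K, W K < 1)
    (hbadA : ∀ K t, |t| ≤ l₀ → ∑ τ ∈ T K \ G K, A K t τ ≤ W K * ∑ τ ∈ T K, A K t τ)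
    (hbadB : ∀ K t, |t| ≤ l₀ → ∑ τ ∈ T K \ G K, B K t τ ≤ W K * ∑ τ ∈ T K, B K t τ)
    (hRM : ∀ K t, |t| ≤ l₀ → ∀ τ ∈ G K,
      |(Real.log (B K t τ) - Real.log (B K 0 τ)) - (Real.log (A K t τ) - Real.log (A K 0 τ))| ≤ r K)
    (hDC : ∀ K t, |t| ≤ l₀ →
      |Real.log (∑ τ ∈ G K, B K 0 τ * (A K t τ / A K 0 τ)) - Real.log (∑ τ ∈ G K, B K 0 τ) -
        (Real.log (∑ τ ∈ G K, A K t τ) - Real.log (∑ τ ∈ G K, A K 0 τ))| ≤ κ K)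
    (hZA : ∀ K t, |t| ≤ l₀ → Z K t = ∑ τ ∈ T K, A K t τ) (hZB : ∀ K t, |t| ≤ l₀ → Z (K + 1) t = ∑ τ ∈ T K, B K t τ)
    (hbud : ∀ K, r K + κ K - 2 * Real.log (1 - W K) ≤ vol * δ K) (hδ : Summable δ) : NE7.Target vol l₀ δ Z := by
  have h0 : |(0 : ℝ)| ≤ l₀ := by simpa using hl₀
  refine ⟨N19CoreMetric.matchingModConstants_of_genFun_increments fun K t ht => ?_, hδ⟩
  simp only [genFun]
  rw [hZB K t ht, hZB K 0 h0, hZA K t ht, hZA K 0 h0]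
  exact (abs_genFunIncr_sub_le_of_response_decorrelation_bad (hG K) (hGne K) (hA K) (hB K) hl₀ (hW K) (hbadA K) (hbadB K)
    (hRM K) (hDC K) ht).trans (hbud K)

end AlongK

/-! ## §4 THE AGING LETTER: (DC) from a response that is class-blind CONDITIONALLY ON THE OLD COORDINATE (generalises FILE C's product and class-blind sources) -/

section Conditional

/-- **(DC) FROM A CONDITIONALLY CLASS-BLIND RESPONSE** (`κ = 2s`).  Classes `T₁ ×ˢ T₂` = (old coordinate) × (recent coordinate) with ARBITRARY positive
source-free weights `A_0` (no product structure), the two-run contrast reading the OLD coordinate only (`B_0 = u(τ₁)·A_0`), and run A's loop response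
class-blind ON AVERAGE OVER THE RECENT COORDINATE, uniformly in the old one: `|log Σ_{τ₂} A_t(τ₁,τ₂) − log Σ_{τ₂} A_0(τ₁,τ₂) − φ t| ≤ s` for every `τ₁`
(«conditionally on the old large-field structure the class-averaged response of the loop is the same» — an AGING statement; FILE C's
`decorrelation_of_product` is the case `s = 0` with product weights, `decorrelation_of_classBlindResponse` the case of a pointwise-blind response).  Then the
`ν_B`- and `ν_A`-means of the response agree up to `e^{±2s}` — however large and law-separating `u`. [folklore] -/
theorem decorrelation_of_conditionallyBlindResponse {ι₁ ι₂ : Type*} {T₁ : Finset ι₁} {T₂ : Finset ι₂} {A B : ℝ → ι₁ × ι₂ → ℝ} {u : ι₁ → ℝ}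
    {l₀ : ℝ} {φ : ℝ → ℝ} {s : ℝ} (hT₁ : T₁.Nonempty) (hT₂ : T₂.Nonempty)
    (hA : ∀ t, |t| ≤ l₀ → ∀ τ ∈ T₁ ×ˢ T₂, 0 < A t τ) (hl₀ : 0 ≤ l₀) (hu : ∀ τ₁ ∈ T₁, 0 < u τ₁)
    (hB0 : ∀ τ ∈ T₁ ×ˢ T₂, B 0 τ = u τ.1 * A 0 τ)
    (hCB : ∀ t, |t| ≤ l₀ → ∀ τ₁ ∈ T₁,
      |Real.log (∑ τ₂ ∈ T₂, A t (τ₁, τ₂)) - Real.log (∑ τ₂ ∈ T₂, A 0 (τ₁, τ₂)) - φ t| ≤ s)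
    {t : ℝ} (ht : |t| ≤ l₀) :
    |Real.log (∑ τ ∈ T₁ ×ˢ T₂, B 0 τ * (A t τ / A 0 τ)) - Real.log (∑ τ ∈ T₁ ×ˢ T₂, B 0 τ) -
        (Real.log (∑ τ ∈ T₁ ×ˢ T₂, A t τ) - Real.log (∑ τ ∈ T₁ ×ˢ T₂, A 0 τ))| ≤ 2 * s := by
  have h0 : |(0 : ℝ)| ≤ l₀ := by simpa using hl₀
  -- conditional (recent-coordinate) sums `R_t(τ₁) = Σ_{τ₂} A_t(τ₁,τ₂)`, positive
  have hRpos : ∀ t', |t'| ≤ l₀ → ∀ τ₁ ∈ T₁, 0 < ∑ τ₂ ∈ T₂, A t' (τ₁, τ₂) := fun t' ht' τ₁ hτ₁ =>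
    Finset.sum_pos (fun τ₂ hτ₂ => hA t' ht' _ (Finset.mem_product.2 ⟨hτ₁, hτ₂⟩)) hT₂
  -- rewrite the four sums over the old coordinate
  have hS : ∑ τ ∈ T₁ ×ˢ T₂, B 0 τ * (A t τ / A 0 τ) = ∑ τ₁ ∈ T₁, u τ₁ * ∑ τ₂ ∈ T₂, A t (τ₁, τ₂) := by
    rw [Finset.sum_product]
    refine Finset.sum_congr rfl fun τ₁ hτ₁ => ?_
    rw [Finset.mul_sum]
    refine Finset.sum_congr rfl fun τ₂ hτ₂ => ?_
    have hmem : (τ₁, τ₂) ∈ T₁ ×ˢ T₂ := Finset.mem_product.2 ⟨hτ₁, hτ₂⟩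
    rw [hB0 _ hmem]
    have := (hA 0 h0 _ hmem).ne'
    field_simp
  have hB : ∑ τ ∈ T₁ ×ˢ T₂, B 0 τ = ∑ τ₁ ∈ T₁, u τ₁ * ∑ τ₂ ∈ T₂, A 0 (τ₁, τ₂) := by
    rw [Finset.sum_product]
    refine Finset.sum_congr rfl fun τ₁ hτ₁ => ?_
    rw [Finset.mul_sum]
    exact Finset.sum_congr rfl fun τ₂ hτ₂ => hB0 _ (Finset.mem_product.2 ⟨hτ₁, hτ₂⟩)
  have hAt : ∑ τ ∈ T₁ ×ˢ T₂, A t τ = ∑ τ₁ ∈ T₁, ∑ τ₂ ∈ T₂, A t (τ₁, τ₂) := Finset.sum_product _ _ _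
  have hA0 : ∑ τ ∈ T₁ ×ˢ T₂, A 0 τ = ∑ τ₁ ∈ T₁, ∑ τ₂ ∈ T₂, A 0 (τ₁, τ₂) := Finset.sum_product _ _ _
  rw [hS, hB, hAt, hA0]
  -- (i) the `u`-tilted old-coordinate sums
  have h1 : |Real.log (∑ τ₁ ∈ T₁, u τ₁ * ∑ τ₂ ∈ T₂, A t (τ₁, τ₂)) - Real.log (∑ τ₁ ∈ T₁, u τ₁ * ∑ τ₂ ∈ T₂, A 0 (τ₁, τ₂)) - φ t| ≤ s := by
    refine abs_log_sum_sub_log_sum_sub_le hT₁ (fun τ₁ hτ₁ => mul_pos (hu τ₁ hτ₁) (hRpos 0 h0 τ₁ hτ₁))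
      (fun τ₁ hτ₁ => mul_pos (hu τ₁ hτ₁) (hRpos t ht τ₁ hτ₁)) fun τ₁ hτ₁ => ?_
    rw [Real.log_mul (hu τ₁ hτ₁).ne' (hRpos t ht τ₁ hτ₁).ne', Real.log_mul (hu τ₁ hτ₁).ne' (hRpos 0 h0 τ₁ hτ₁).ne']
    have e : Real.log (u τ₁) + Real.log (∑ τ₂ ∈ T₂, A t (τ₁, τ₂)) - (Real.log (u τ₁) + Real.log (∑ τ₂ ∈ T₂, A 0 (τ₁, τ₂))) - φ t =
        Real.log (∑ τ₂ ∈ T₂, A t (τ₁, τ₂)) - Real.log (∑ τ₂ ∈ T₂, A 0 (τ₁, τ₂)) - φ t := by ring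
    rw [e]; exact hCB t ht τ₁ hτ₁
  -- (ii) the plain old-coordinate sums
  have h2 : |Real.log (∑ τ₁ ∈ T₁, ∑ τ₂ ∈ T₂, A t (τ₁, τ₂)) - Real.log (∑ τ₁ ∈ T₁, ∑ τ₂ ∈ T₂, A 0 (τ₁, τ₂)) - φ t| ≤ s :=
    abs_log_sum_sub_log_sum_sub_le hT₁ (fun τ₁ hτ₁ => hRpos 0 h0 τ₁ hτ₁) (fun τ₁ hτ₁ => hRpos t ht τ₁ hτ₁) (hCB t ht)
  rw [abs_le] at h1 h2 ⊢
  constructor <;> linarith [h1.1, h1.2, h2.1, h2.2]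

end Conditional

end Summit.QuantumFields.YangMills.BalabanUVNodes.N19TargetOfDecorrelationReadingWitness

end
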